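import Summits.BirchSwinnertonDyer.BirchSwinnertonDyer.Theses.UniversalToricDescent
import Literature.NumberTheory.GaloisRepresentations.NumberFieldCdTwoProofs
import HarnessLib

/-!
# Route `UniversalToricDescent` — support leaf `NumberFieldCdLETwoFact`
# (stmt-BirchSwinnertonDyer-20464): a tree THEOREM, by name

Seat `bsd-potss-kmc`, gen 18 (cell `bsd-potss`; kernel service on route `UniversalToricDescent`,
rev 11). Leaf 4/7 of crux #5's published-fact split: `cd_p ≤ 2` for number fields is the tree
theorem `Literature.NumberTheory.GaloisRepresentations.fieldCdLE_two_of_numberField_holds`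
(module `Literature/NumberTheory/GaloisRepresentations/NumberFieldCdTwoProofs`). HONEST FRAMING: one
token; BSD is not advanced by this.

References: [SerreGaloisCohomology1997] II §4.4 Prop. 13; [MilneADT2006] I Thm. 4.10 (proof).
-/

set_option linter.dupNamespace false

namespace Summit.BirchSwinnertonDyer.BirchSwinnertonDyer.Theorems

open Summit.BirchSwinnertonDyer.BirchSwinnertonDyer.Theses.UniversalToricDescent

/-- **Leaf `NumberFieldCdLETwoFact` (item 20464) holds**: `cd_p(G_K) ≤ 2` for every number field
and every prime `p` — the tree theorem `fieldCdLE_two_of_numberField_holds`.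
[cite: SerreGaloisCohomology1997, II §4.4 Prop. 13] -/
theorem numberFieldCdLETwoFact_proof : NumberFieldCdLETwoFact := by
  unfold NumberFieldCdLETwoFact
  exact Literature.NumberTheory.GaloisRepresentations.fieldCdLE_two_of_numberField_holds

end Summit.BirchSwinnertonDyer.BirchSwinnertonDyer.Theorems
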